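import Mathlib
import Summits.NavierStokesRegularity.NavierStokesRegularity.Theorems.RootDecompLitSliceDarkBallSpreadsVorticityFlatness
import Summits.NavierStokesRegularity.NavierStokesRegularity.Theorems.RootDecompLitSliceDarkBallSpreadsRegularPointSmoothing
import Summits.NavierStokesRegularity.NavierStokesRegularity.Theorems.RootDecompLitSliceDarkBallSpreadsTerminalLimit
import Summits.NavierStokesRegularity.NavierStokesRegularity.Theorems.RootDecompLitSliceDarkBallSpreadsComplConnected
import HarnessLib

/-!
# Route RootDecompLitSlice — brick B3 «FLAT INTERFACE» of the aside D₁ `DarkBallSpreads`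
  (stmt-NavierStokesRegularity-29566, the registered stub `stub_darkBallSpreads` of crux D `NoDarkBall`
  stmt-NavierStokesRegularity-29563)

The adapter announced on the decomp-ns bus (census L1203 (2), critic L1204 (v), claimed by census g29
L1207): it delivers the hypothesis `hflat` («FLAT») of the writer's local spread step
`localSpread_of_flatVorticity` (brick B4-application) in EXACTLY the shape requested on the bus
(writer L1202), from three landed bricks:

* B1 `regularPoint_iteratedFDeriv_bounds` (census): at a regular terminal point `x₁ ∉ Σ_T` there is a
  backward cylinder `Q_r(T, x₁)`, `r² < T`, on which every spatial derivative `Dⁿu` is bounded and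
  space–time Hölder;
* the derivative tower `contDiffOn_and_tendstoUniformlyOn_iteratedFDeriv_of_holder` (writer, B1′): on the
  open set `U = B(x₁, r) ∩ Σ_Tᶜ`, where the pointwise terminal limit `w` is pinned by `hw`, every
  `Dⁿ(u t) → Dⁿw` uniformly as `t → T⁻`;
* B3-NS `vorticity_flat_of_tendsto_zero` (census): bounded derivatives on the cylinder + vanishing terminal
  limits of all `Dⁿ curl (u t)` on a set `s ⊆ B(x₁, r)` ⟹ `‖Dⁿ curl (u t)‖ ≤ C_k(n) (T − t)^k` on `s`.

The one computation in between is `Dⁿ(curl v)(x) = curlCLM ∘ (curry D^{n+1}v(x))`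
(`iteratedFDeriv_curl_eq`): a FIXED continuous linear map applied to `D^{n+1}v(x)`, so the tower at
order `n + 1` gives `Dⁿ curl (u t) x → Dⁿ (curl w) x`, which is `0` on the open ball `B(x₁, δ)` where
`curl w` vanishes. Taking `n = 0` (`‖D⁰f x‖ = ‖f x‖`) yields FLAT with `τ = r²`.

Statement (`flatVorticity_of_terminalLimit`), under the writer's binders `hν hT hsol hLH hdec` and
`hw : ∀ y ∈ Σ_Tᶜ, u t y → w y`:
  `∀ x₁ ∈ Σ_Tᶜ, (∀ᶠ y in 𝓝 x₁, curl w y = 0) → ∃ δ > 0, ∃ τ > 0, ∀ k, ∃ C, ∀ t ∈ (T − τ, T),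
   ∀ x ∈ B(x₁, δ), ‖curl (u t) x‖ ≤ C (T − t)^k`.

HONEST FRAMING: glue between landed bricks; closes no item by itself; D₁ and every brick of it are
DECORATIVE for the summit per D-0179 (the summit-hard leaves are N16's residual U 29565 / N20's M₂);
nothing here bears on NS regularity (rung 0). Lands `--supports stmt-NavierStokesRegularity-29566`
(decomp-ns census instrument g29). [folklore]
-/

noncomputable section

open Set Filter Topology Metric Function
open scoped NNReal ContDiff
open Literature.Analysis Literature.Analysis.FluidPDE

-- the summit and its single sub-problem share the name (CONVENTIONS §1), as in every Theorems file
set_option linter.dupNamespace false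

namespace Summit.NavierStokesRegularity.NavierStokesRegularity.Theorems

/-- **`Dⁿ curl = L ∘ Dⁿ⁺¹`.** For `v` of class `C^{n+1}` at `x`, the `n`-th derivative of `curl v` at `x`
is `curlCLM` composed with the right-curried `(n+1)`-st derivative of `v` at `x`. [folklore] -/
theorem iteratedFDeriv_curl_eq {v : EuclideanSpace ℝ (Fin 3) → EuclideanSpace ℝ (Fin 3)}
    {x : EuclideanSpace ℝ (Fin 3)} {n : ℕ} (hv : ContDiffAt ℝ ((n + 1 : ℕ) : ℕ∞) v x) :
    iteratedFDeriv ℝ n (curl v) x =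
      curlCLM.compContinuousMultilinearMap
        (continuousMultilinearCurryRightEquiv' ℝ n (EuclideanSpace ℝ (Fin 3)) (EuclideanSpace ℝ (Fin 3))
          (iteratedFDeriv ℝ (n + 1) v x)) := by
  have hD : ContDiffAt ℝ (n : ℕ∞) (fderiv ℝ v) x := hv.fderiv_right (by norm_cast)
  rw [curl_eq_curlCLM_comp, curlCLM.iteratedFDeriv_comp_left hD (i := n) (by exact_mod_cast le_rfl),
    iteratedFDeriv_succ_eq_comp_right, Function.comp_apply, LinearIsometryEquiv.apply_symm_apply]

/-- **Terminal limits of the derivatives of the vorticity.** If `D^{n+1}(u t) x → D^{n+1} w x` as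
`t → T⁻`, the slices `u t` (for `t < T` near `T`) and `w` being `C^{n+1}` at `x`, then
`Dⁿ curl (u t) x → Dⁿ (curl w) x`. [folklore] -/
theorem tendsto_iteratedFDeriv_curl_of_tendsto_succ {T : ℝ}
    {u : ℝ → EuclideanSpace ℝ (Fin 3) → EuclideanSpace ℝ (Fin 3)}
    {w : EuclideanSpace ℝ (Fin 3) → EuclideanSpace ℝ (Fin 3)} {x : EuclideanSpace ℝ (Fin 3)} {n : ℕ}
    (hu : ∀ᶠ t in 𝓝[<] T, ContDiffAt ℝ ((n + 1 : ℕ) : ℕ∞) (u t) x)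
    (hwx : ContDiffAt ℝ ((n + 1 : ℕ) : ℕ∞) w x)
    (hlim : Tendsto (fun t => iteratedFDeriv ℝ (n + 1) (u t) x) (𝓝[<] T)
      (𝓝 (iteratedFDeriv ℝ (n + 1) w x))) :
    Tendsto (fun t => iteratedFDeriv ℝ n (curl (u t)) x) (𝓝[<] T) (𝓝 (iteratedFDeriv ℝ n (curl w) x)) := by
  set Ψ : ((EuclideanSpace ℝ (Fin 3)) [×(n + 1)]→L[ℝ] (EuclideanSpace ℝ (Fin 3))) →
      ((EuclideanSpace ℝ (Fin 3)) [×n]→L[ℝ] (EuclideanSpace ℝ (Fin 3))) := fun M =>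
    curlCLM.compContinuousMultilinearMap
      (continuousMultilinearCurryRightEquiv' ℝ n (EuclideanSpace ℝ (Fin 3)) (EuclideanSpace ℝ (Fin 3)) M)
    with hΨ_def
  have hΨ : Continuous Ψ :=
    (ContinuousLinearMap.continuous_postcomp_continuousMultilinearMap _).comp
      (continuousMultilinearCurryRightEquiv' ℝ n (EuclideanSpace ℝ (Fin 3)) (EuclideanSpace ℝ (Fin 3))).continuous
  have h2 : Tendsto (fun t => Ψ (iteratedFDeriv ℝ (n + 1) (u t) x)) (𝓝[<] T)
      (𝓝 (Ψ (iteratedFDeriv ℝ (n + 1) w x))) :=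
    (hΨ.tendsto _).comp hlim
  rw [iteratedFDeriv_curl_eq hwx]
  refine h2.congr' ?_
  filter_upwards [hu] with t ht
  rw [iteratedFDeriv_curl_eq ht]

/-- **Brick B3 «FLAT INTERFACE» (census g29).** Let `ν, T > 0`, `(u, p)` classical on `[0, T)`,
Leray–Hopf on `[0, T]` from a rapidly decaying datum, and `w` the pointwise limit of `u t` on the regular
terminal slice `Σ_Tᶜ = {x | IsBackwardSingularPoint u (T, x)}ᶜ`. If `curl w` vanishes near a regular
point `x₁`, then the vorticity vanishes to infinite parabolic order at `(T, x₁)`: there are `δ, τ > 0`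
with `‖curl (u t) x‖ ≤ C_k (T − t)^k` for all `t ∈ (T − τ, T)`, `x ∈ B(x₁, δ)` and every `k`. This is
the hypothesis `hflat` of the writer's `localSpread_of_flatVorticity` (B4-application), verbatim.
[folklore] -/
theorem flatVorticity_of_terminalLimit {ν T : ℝ} (hν : 0 < ν) (hT : 0 < T)
    {u : ℝ → EuclideanSpace ℝ (Fin 3) → EuclideanSpace ℝ (Fin 3)}
    {p : ℝ → EuclideanSpace ℝ (Fin 3) → ℝ}
    (hsol : IsClassicalNSSolutionOn (Ico 0 T) ν 0 u p) (hLH : IsLerayHopfOn T ν 0 (u 0) u)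
    (hdec : HasRapidSpatialDecay (u 0))
    {w : EuclideanSpace ℝ (Fin 3) → EuclideanSpace ℝ (Fin 3)}
    (hw : ∀ y ∈ {x : EuclideanSpace ℝ (Fin 3) | IsBackwardSingularPoint u (T, x)}ᶜ,
      Tendsto (fun t => u t y) (𝓝[<] T) (𝓝 (w y))) :
    ∀ x₁ ∈ {x : EuclideanSpace ℝ (Fin 3) | IsBackwardSingularPoint u (T, x)}ᶜ,
      (∀ᶠ y in 𝓝 x₁, curl w y = 0) →
        ∃ δ > 0, ∃ τ > 0, ∀ k : ℕ, ∃ C : ℝ,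
          ∀ t ∈ Ioo (T - τ) T, ∀ x ∈ ball x₁ δ, ‖curl (u t) x‖ ≤ C * (T - t) ^ k := by
  intro x₁ hx₁ hflat
  -- B1 at the regular point `x₁`
  obtain ⟨r, hr, hrT, hH⟩ := regularPoint_iteratedFDeriv_bounds hν hT hsol hLH hdec hx₁
  have hab : T - r ^ 2 < T := by nlinarith
  -- the open set `U = B(x₁, r) ∩ Σ_Tᶜ`, on which `w` is the pointwise limit
  have hSo : IsOpen {x : EuclideanSpace ℝ (Fin 3) | IsBackwardSingularPoint u (T, x)}ᶜ :=
    (isClosed_backwardSingularSlice u T).isOpen_compl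
  set U : Set (EuclideanSpace ℝ (Fin 3)) :=
    ball x₁ r ∩ {x : EuclideanSpace ℝ (Fin 3) | IsBackwardSingularPoint u (T, x)}ᶜ with hU_def
  have hU : IsOpen U := isOpen_ball.inter hSo
  have hx₁U : x₁ ∈ U := ⟨mem_ball_self hr, hx₁⟩
  have hUsub : Ioo (T - r ^ 2) T ×ˢ U ⊆ parabolicCylinder r ((T : ℝ), x₁) := by
    rintro ⟨t, y⟩ ⟨ht, hy⟩
    simp only [mem_parabolicCylinder]
    exact ⟨ht, mem_ball.1 hy.1⟩
  have hSm : ∀ s ∈ Ioo (T - r ^ 2) T, ∀ y ∈ U, ContDiffAt ℝ ∞ (u s) y := fun s hs y _ =>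
    (hsol.contDiff_velocity ⟨by nlinarith [hs.1], hs.2⟩).contDiffAt
  have hH' : ∀ n : ℕ, ∃ C α : ℝ≥0, 0 < α ∧
      HolderOnWith C α (fun z : ℝ × EuclideanSpace ℝ (Fin 3) => iteratedFDeriv ℝ n (u z.1) z.2)
        (Ioo (T - r ^ 2) T ×ˢ U) := by
    intro n
    obtain ⟨K, C, α, hα, hHn, -⟩ := hH n
    exact ⟨C, α, hα, hHn.mono hUsub⟩
  have hw' : ∀ y ∈ U, Tendsto (fun s => u s y) (𝓝[<] T) (𝓝 (w y)) := fun y hy => hw y hy.2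
  have htower := contDiffOn_and_tendstoUniformlyOn_iteratedFDeriv_of_holder hab hU hSm hH' hw'
  -- `δ`: the ball `B(x₁, δ)` lies in `U` and in the zero set of `curl w`
  obtain ⟨δ, hδ, hball⟩ := Metric.mem_nhds_iff.1 (inter_mem (hU.mem_nhds hx₁U) hflat)
  have hδU : ball x₁ δ ⊆ U := fun y hy => (hball hy).1
  have hδr : ball x₁ δ ⊆ ball x₁ r := fun y hy => (hball hy).1.1
  refine ⟨δ, hδ, r ^ 2, by positivity, ?_⟩
  -- the bounds of B1 in the shape of B3-NS
  have hK : ∀ n : ℕ, ∃ K : ℝ, ∀ t ∈ Ioo (T - r ^ 2) T, ∀ x ∈ ball x₁ r,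
      ‖iteratedFDeriv ℝ n (u t) x‖ ≤ K := by
    intro n
    obtain ⟨K, C, α, -, -, hB⟩ := hH n
    refine ⟨K, fun t ht x hx => hB (t, x) ?_⟩
    simp only [mem_parabolicCylinder]
    exact ⟨ht, mem_ball.1 hx⟩
  -- the terminal limits of all `Dⁿ curl (u t)` vanish on `B(x₁, δ)`
  have hlim : ∀ n : ℕ, ∀ x ∈ ball x₁ δ,
      Tendsto (fun t => iteratedFDeriv ℝ n (curl (u t)) x) (𝓝[<] T) (𝓝 0) := by
    intro n x hx
    have hxU : x ∈ U := hδU hx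
    -- `curl w = 0` near `x`, hence `Dⁿ (curl w) x = 0`
    have hcw : curl w =ᶠ[𝓝 x] fun _ => (0 : EuclideanSpace ℝ (Fin 3)) := by
      filter_upwards [isOpen_ball.mem_nhds hx] with y hy using (hball hy).2
    have h0 : iteratedFDeriv ℝ n (curl w) x = 0 := by
      rw [(hcw.iteratedFDeriv ℝ n).eq_of_nhds, iteratedFDeriv_fun_zero]
      rfl
    -- the tower at order `n + 1`, pushed through `Dⁿ curl = L ∘ Dⁿ⁺¹`
    have hwx : ContDiffAt ℝ ((n + 1 : ℕ) : ℕ∞) w x :=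
      ((htower.1.contDiffAt (hU.mem_nhds hxU)).of_le (by exact_mod_cast le_top))
    have hu : ∀ᶠ t in 𝓝[<] T, ContDiffAt ℝ ((n + 1 : ℕ) : ℕ∞) (u t) x := by
      filter_upwards [Ioo_mem_nhdsLT hT] with t ht
      exact ((hsol.contDiff_velocity ⟨ht.1.le, ht.2⟩).of_le (by exact_mod_cast le_top)).contDiffAt
    have h1 := tendsto_iteratedFDeriv_curl_of_tendsto_succ hu hwx ((htower.2 (n + 1)).tendsto_at hxU)
    rwa [h0] at h1
  -- B3-NS at order `0`
  intro k
  obtain ⟨C, -, hC⟩ := vorticity_flat_of_tendsto_zero hrT hsol hδr hK hlim k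
  refine ⟨C 0, fun t ht x hx => ?_⟩
  have h := hC 0 x hx t ht
  rwa [norm_iteratedFDeriv_zero] at h

end Summit.NavierStokesRegularity.NavierStokesRegularity.Theorems
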